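import Literature.Combinatorics.Optimization.DualConeExtensionDegree
import Literature.Combinatorics.Optimization.MomentConeDuality
import HarnessLib

/-!
# `sxd(M_{n,D}(X)) = sxd(P_{n,D}(X))` for every `X ⊆ ℝⁿ` (Averkov 2019: (2.2) dualised through Lemma 32)

G. Averkov, *Optimal size of linear matrix inequalities in semidefinite approaches to polynomial
optimization*, SIAM J. Appl. Algebra Geom. **3** (2019) = arXiv:1806.08656 [cite: Averkov2019] (held text
`paper:arxiv-1806.08656`; `pNN` = page of that text). Everything here is PROVED; no facts are asserted.

p06, verbatim: "Results from [GPT:2013] imply that `sxc(C)` and `sxd(C)` are invariant under duality of cones …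
(2.2) `sxd(C) = sxd(C^*)` … Via dualization, Corollaries 3 and 4 yield a number of consequences. We introduce
the moment cones `M_{n,2d}(X)` …"; p13, verbatim: "Moment cones are known to be dual to cones of non-negative
polynomials: Lemma 32. … `(P_{n,2d}(X))^* = M_{n,2d}(X)`. … Proof of Corollary 14. In view of Lemma 32 and
(2.2), the assertion follows from Corollary 3. Proof of Corollary 15. The assertion follows from
Corollary 12, Theorem 13, Lemma 32, and (2.2)."

The dualisation step itself — **`sxd(M_{n,D}(X)) = sxd(P_{n,D}(X))`** — is made a theorem here, for EVERY
`X ⊆ ℝⁿ` and every degree bound `D` (`Averkov2019_sxd_momentCone_eq_nonnegPolynomialCone`,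
`hasBlockPsdLift_momentCone_exists_iff`): the tree's Lemma 32 (`momentCone_eq_dual`, `MomentConeDuality.lean`)
says `M_{n,D}(X)` is the dot-product dual of the coefficient cone `coeffVec(P_{n,D}(X)) = {c : ⟨v_D(x), c⟩ ≥ 0
∀ x ∈ X}` (itself the dual cone of the moment vectors, hence closed and convex), and the tree's unconditional
(2.2) (`hasBlockPsdLift_dualCone_exists_iff`, `DualConeExtensionDegree.lean` — Remark 20's reduction, so no
"`X` with non-empty interior" is needed for this step) transfers `(S^d_+)^m`-lifts, `m` free, `d ≥ 1`. Lifts of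
`P_{n,D}(X) ⊆ ℝ[x]` and of its coefficient image correspond through the tree's `coeffVec`/`ofVec`
(`SosConeSemidefiniteExtensionDegree.lean`).
-/

noncomputable section

open Finset Matrix MvPolynomial

namespace Literature.Combinatorics.Optimization

open SosCone

variable {n D : ℕ}

/-- **The coefficient cone of `P_{n,D}(X)`**: coefficient vectors `c ∈ ℝ^{binom(n+D,n)}` with `⟨v_D(x), c⟩ ≥ 0`
for all `x ∈ X` — the dual cone of the moment vectors of `X`. [cite: Averkov2019, Lemma 32 (p13) and Remark 23 (p10, `f(x) = ⟨f, v(x)⟩`)] -/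
def nonnegCoeffCone (n D : ℕ) (X : Set (Fin n → ℝ)) : Set (Idx n D → ℝ) :=
  dualCone (momentVector D '' X)

/-- Membership: `c ∈ nonnegCoeffCone ⟺ ⟨v_D(x), c⟩ ≥ 0` on `X`. [cite: Averkov2019, Lemma 32 (p13)] -/
theorem mem_nonnegCoeffCone_iff {X : Set (Fin n → ℝ)} {c : Idx n D → ℝ} :
    c ∈ nonnegCoeffCone n D X ↔ ∀ x ∈ X, 0 ≤ momentVector D x ⬝ᵥ c := by
  constructor
  · intro h x hx
    exact h _ ⟨x, hx, rfl⟩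
  · rintro h _ ⟨x, hx, rfl⟩
    exact h x hx

/-- `coeffVec(P_{n,D}(X)) = nonnegCoeffCone` (evaluation is the scalar product with the moment vector).
[cite: Averkov2019, Remark 23 (p10) and Lemma 32 (p13)] -/
theorem image_coeffVec_nonnegPolynomialCone (X : Set (Fin n → ℝ)) :
    coeffVec n D '' nonnegPolynomialCone n D X = nonnegCoeffCone n D X := by
  ext c
  rw [mem_nonnegCoeffCone_iff]
  constructor
  · rintro ⟨f, hf, rfl⟩ x hx
    rw [← eval_eq_dotProduct hf.1]
    exact hf.2 x hx
  · intro hc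
    refine ⟨ofVec n D c, ⟨totalDegree_ofVec_le c, fun x hx => ?_⟩, coeffVec_ofVec c⟩
    rw [eval_ofVec]
    exact hc x hx

/-- `P_{n,D}(X) = ofVec(nonnegCoeffCone)`. [cite: Averkov2019, Remark 23 (p10) and Lemma 32 (p13)] -/
theorem nonnegPolynomialCone_eq_image_ofVec (X : Set (Fin n → ℝ)) :
    nonnegPolynomialCone n D X = ofVec n D '' nonnegCoeffCone n D X := by
  ext f
  constructor
  · intro hf
    refine ⟨coeffVec n D f, ?_, ofVec_coeffVec hf.1⟩
    rw [← image_coeffVec_nonnegPolynomialCone]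
    exact ⟨f, hf, rfl⟩
  · rintro ⟨c, hc, rfl⟩
    rw [mem_nonnegCoeffCone_iff] at hc
    exact ⟨totalDegree_ofVec_le c, fun x hx => by rw [eval_ofVec]; exact hc x hx⟩

/-- Lifts of `P_{n,D}(X) ⊆ ℝ[x]` and of its coefficient cone correspond, same `d` and `m` (linear images both
ways). [cite: Averkov2019, Remark 23 (p10, the identification `ℝ[x]_D ≅ ℝ^{binom(n+D,n)}`)] -/
theorem hasBlockPsdLift_nonnegPolynomialCone_iff_coeff (X : Set (Fin n → ℝ)) {d m : ℕ} :
    HasBlockPsdLift (nonnegPolynomialCone n D X) d m ↔ HasBlockPsdLift (nonnegCoeffCone n D X) d m := by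
  constructor
  · intro h
    rw [← image_coeffVec_nonnegPolynomialCone]
    exact h.image _
  · intro h
    rw [nonnegPolynomialCone_eq_image_ofVec]
    exact h.image _

/-- **Lemma 32 in coordinates: `M_{n,D}(X) = (nonnegCoeffCone)^*`** (dot-product dual).
[cite: Averkov2019, Lemma 32 (p13)] -/
theorem momentCone_eq_dualCone_nonnegCoeffCone (X : Set (Fin n → ℝ)) :
    momentCone n D X = dualCone (nonnegCoeffCone n D X) := by
  rw [momentCone_eq_dual, ← image_coeffVec_nonnegPolynomialCone]
  ext y
  constructor
  · rintro hy _ ⟨f, hf, rfl⟩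
    rw [dotProduct_comm]
    exact hy f hf
  · intro hy f hf
    rw [dotProduct_comm]
    exact hy _ ⟨f, hf, rfl⟩

/-- **`M_{n,D}(X)` has an `(S^d_+)^m`-lift for some `m` iff `P_{n,D}(X)` does** (`d ≥ 1`), for every
`X ⊆ ℝⁿ` and every `D`: (2.2) for the closed convex cone `nonnegCoeffCone` and Lemma 32.
[cite: Averkov2019, (2.2) (p06), Lemma 32 and proofs of Cor. 14–15 (p13)] -/
theorem hasBlockPsdLift_momentCone_exists_iff (X : Set (Fin n → ℝ)) {d : ℕ} (hd : 1 ≤ d) :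
    (∃ m, HasBlockPsdLift (momentCone n D X) d m) ↔ ∃ m, HasBlockPsdLift (nonnegPolynomialCone n D X) d m := by
  classical
  rw [momentCone_eq_dualCone_nonnegCoeffCone]
  have h := hasBlockPsdLift_dualCone_exists_iff (C := nonnegCoeffCone n D X) hd (convex_dualCone _)
    (isClosed_dualCone _) (fun x _ => by rw [dotProduct_zero]) (fun y hy t ht => smul_mem_dualCone hy ht)
  rw [h]
  exact ⟨fun ⟨m, hm⟩ => ⟨m, (hasBlockPsdLift_nonnegPolynomialCone_iff_coeff X).2 hm⟩,
    fun ⟨m, hm⟩ => ⟨m, (hasBlockPsdLift_nonnegPolynomialCone_iff_coeff X).1 hm⟩⟩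

/-- The feasible block sizes (`≥ 1`) of `M_{n,D}(X)` and `P_{n,D}(X)` coincide. [cite: Averkov2019, (2.2) (p06) and Lemma 32 (p13)] -/
theorem setOf_blockSize_momentCone_eq (X : Set (Fin n → ℝ)) :
    {d | 1 ≤ d ∧ ∃ m, HasBlockPsdLift (momentCone n D X) d m} =
      {d | 1 ≤ d ∧ ∃ m, HasBlockPsdLift (nonnegPolynomialCone n D X) d m} := by
  ext d
  simp only [Set.mem_setOf_eq]
  exact ⟨fun ⟨hd, h⟩ => ⟨hd, (hasBlockPsdLift_momentCone_exists_iff X hd).1 h⟩,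
    fun ⟨hd, h⟩ => ⟨hd, (hasBlockPsdLift_momentCone_exists_iff X hd).2 h⟩⟩

/-- **Averkov 2019, the dualisation behind Cor. 14–15: `sxd(M_{n,D}(X)) = sxd(P_{n,D}(X))`** for every
`X ⊆ ℝⁿ` and degree bound `D` (`IsLeast` form over block sizes `≥ 1`; no interior hypothesis on `X`).
[cite: Averkov2019, (2.2) (p06), Lemma 32 and proofs of Cor. 14–15 (p13)] -/
theorem Averkov2019_sxd_momentCone_eq_nonnegPolynomialCone (X : Set (Fin n → ℝ)) (d₀ : ℕ) :
    IsLeast {d | 1 ≤ d ∧ ∃ m, HasBlockPsdLift (momentCone n D X) d m} d₀ ↔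
      IsLeast {d | 1 ≤ d ∧ ∃ m, HasBlockPsdLift (nonnegPolynomialCone n D X) d m} d₀ := by
  rw [setOf_blockSize_momentCone_eq]

end Literature.Combinatorics.Optimization
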